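import Literature.NumberTheory.DiophantineGeometry.BertiniNewtonProofs
import Literature.NumberTheory.DiophantineGeometry.BertiniShapeProofs
import Literature.NumberTheory.DiophantineGeometry.BertiniResultantProofs
import Literature.NumberTheory.DiophantineGeometry.BertiniMinorProofs
import Literature.NumberTheory.DiophantineGeometry.BertiniLocalIrreducibilityProofs
import Mathlib.LinearAlgebra.Matrix.Nondegenerate
import HarnessLib

/-!
# The irreducibility certificate `Υ(Z)` of a generic plane section (Kaltofen's Theorem 5)

Let `E` be a field, `χ ∈ E[Z][Y][X]` (outer `X`, inner `Y`, `E[Z] = MvPolynomial (Fin n) E`)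
irreducible of `X`-degree `δ ≥ 1` with nonzero constant leading coefficient, total degree `δ` in
`(X, Y)`, coefficients of `Xᵉ Yʲ` of `Z`-degree `≤ j`, and reduction `χ(X, 0, Z) = g(X)` with a
simple root `α ∈ E` of `g`. Then there is a nonzero `Υ ∈ E[Z]` of total degree
`≤ δ²(2δ² - δ)` such that for every `γ ∈ Eⁿ` with `Υ(γ) ≠ 0` the specialised plane section
`χ(X, Y, γ) ∈ E[Y][X]` is irreducible (`exists_irreducibility_certificate`). This is Kaltofen's
effective Hilbert irreducibility theorem [Kal95, Thm. 5] in the form used by Cafure–Matera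
(2006, §3.2, Cor. 3.2, with a cruder but sufficient degree bound `δ²(2δ²-δ) ≤ 2δ⁴`).

Proof (assembling the sibling files): Newton–Hensel lifting gives `a ∈ E[Z][Y]` with
`χ(a) ≡ 0 mod Y^{2κ}`, `κ = (2δ-1)δ + 1`, whose `Yʲ`-coefficient has `Z`-degree `≤ j`
(`BertiniNewtonProofs`, `BertiniShapeProofs`); the `E[Z]`-matrix `M` of
`h ↦ (first κ Y-coefficients of h(a))` on `h = ∑_{e,j<δ} w_{ej} Xᵉ Yʲ` has independent columns by
the resultant argument (`BertiniResultantProofs`), hence a nonzero maximal minor `Υ` of degree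
`≤ δ²(κ-1)` (`BertiniMinorProofs`); if `Υ(γ) ≠ 0` the specialised matrix is injective, so no small
`h` annihilates the specialised truncated root, and `χ(X, Y, γ)` is irreducible
(`BertiniLocalIrreducibilityProofs`).

## References

* E. Kaltofen, J. Comput. System Sci. 50 (1995) 274–295, Thm. 5. [Kaltofen1995]
* A. Cafure, G. Matera, Finite Fields Appl. 12 (2006) 155–185, §3.2, Cor. 3.2, Thm. 3.3.
  [CafureMatera2006]
-/

noncomputable section

open scoped Classical Polynomial
open Polynomial

namespace Literature.NumberTheory.DiophantineGeometry

universe u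

/-! ### The small polynomials `h_w = ∑_{e,j<δ} w_{ej} Xᵉ Yʲ` and their evaluation -/

section Small

variable {A : Type u} [CommRing A] {δ : ℕ}

/-- Coefficient extraction for `∑ᵢ bᵢ Xⁱ` (`i < δ`). [folklore] -/
theorem coeff_sum_C_mul_X_pow {B : Type*} [Semiring B] (b : Fin δ → B) (e : Fin δ) :
    (∑ i : Fin δ, C (b i) * X ^ (i : ℕ)).coeff (e : ℕ) = b e := by
  rw [finsetSum_coeff]
  simp_rw [coeff_C_mul_X_pow]
  rw [Finset.sum_eq_single e, if_pos rfl]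
  · intro i _ hi; rw [if_neg (fun h ↦ hi (Fin.ext h).symm)]
  · intro h; exact absurd (Finset.mem_univ _) h

/-- Coefficients of `∑ᵢ bᵢ Xⁱ` (`i < δ`) beyond `δ` vanish. [folklore] -/
theorem coeff_sum_C_mul_X_pow_eq_zero {B : Type*} [Semiring B] (b : Fin δ → B) {e : ℕ}
    (he : δ ≤ e) : (∑ i : Fin δ, C (b i) * X ^ (i : ℕ)).coeff e = 0 := by
  rw [finsetSum_coeff]
  refine Finset.sum_eq_zero fun i _ ↦ ?_
  rw [coeff_C_mul_X_pow, if_neg]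
  have := i.2; omega

/-- `∑ᵢ bᵢ Xⁱ` (`i < δ`) has degree `≤ δ - 1`. [folklore] -/
theorem natDegree_sum_C_mul_X_pow_le {B : Type*} [Semiring B] (b : Fin δ → B) (hδ : 1 ≤ δ) :
    (∑ i : Fin δ, C (b i) * X ^ (i : ℕ)).natDegree ≤ δ - 1 := by
  rw [natDegree_le_iff_coeff_eq_zero]
  intro e he
  exact coeff_sum_C_mul_X_pow_eq_zero b (by omega)

/-- A polynomial of degree `< δ` is `∑_{i<δ} (coeff i) Xⁱ`. [folklore] -/
theorem eq_sum_C_mul_X_pow {B : Type*} [Semiring B] {P : B[X]} (hδ : 1 ≤ δ)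
    (hP : P.natDegree ≤ δ - 1) : P = ∑ i : Fin δ, C (P.coeff i) * X ^ (i : ℕ) := by
  ext e
  by_cases he : e < δ
  · exact (coeff_sum_C_mul_X_pow (fun i : Fin δ ↦ P.coeff i) ⟨e, he⟩).symm
  · rw [coeff_sum_C_mul_X_pow_eq_zero _ (not_lt.1 he),
      coeff_eq_zero_of_natDegree_lt (lt_of_le_of_lt hP (Nat.sub_one_lt_of_le hδ (not_lt.1 he)))]

/-- Coefficients of `h_w = ∑ₑ (∑ⱼ w_{ej} Yʲ) Xᵉ`: the coefficient of `Xᵉ Yʲ` is `w (e, j)`.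
[folklore] -/
theorem coeff_coeff_small (w : Fin δ × Fin δ → A) (e j : Fin δ) :
    ((∑ e' : Fin δ, C (∑ j' : Fin δ, C (w (e', j')) * X ^ (j' : ℕ)) * X ^ (e' : ℕ) : A[X][X]).coeff
      e).coeff j = w (e, j) := by
  rw [coeff_sum_C_mul_X_pow, coeff_sum_C_mul_X_pow]

/-- The `X`-coefficients of `h_w` have `Y`-degree `≤ δ - 1`. [folklore] -/
theorem natDegree_coeff_small_le (w : Fin δ × Fin δ → A) (hδ : 1 ≤ δ) (e : ℕ) :
    ((∑ e' : Fin δ, C (∑ j' : Fin δ, C (w (e', j')) * X ^ (j' : ℕ)) * X ^ (e' : ℕ) : A[X][X]).coeff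
      e).natDegree ≤ δ - 1 := by
  by_cases he : e < δ
  · have := coeff_sum_C_mul_X_pow (fun e' : Fin δ ↦ ∑ j' : Fin δ, C (w (e', j')) * X ^ (j' : ℕ))
      ⟨e, he⟩
    rw [Fin.val_mk] at this
    rw [this]
    exact natDegree_sum_C_mul_X_pow_le _ hδ
  · rw [coeff_sum_C_mul_X_pow_eq_zero _ (not_lt.1 he), natDegree_zero]
    exact Nat.zero_le _

/-- **Evaluation of `h_w` at `a`:** the `Yᵏ`-coefficient of `h_w(a)` is
`∑_{e,j} w_{ej} · (Yʲ aᵉ)_k`,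
the product of the matrix `M_{k,(e,j)} = (Yʲ aᵉ)_k` with `w`. [folklore] -/
theorem coeff_eval_small (w : Fin δ × Fin δ → A) (a : A[X]) (k : ℕ) :
    ((∑ e' : Fin δ, C (∑ j' : Fin δ, C (w (e', j')) * X ^ (j' : ℕ)) * X ^ (e' : ℕ) : A[X][X]).eval
      a).coeff k = ∑ p : Fin δ × Fin δ, w p * (X ^ (p.2 : ℕ) * a ^ (p.1 : ℕ)).coeff k := by
  rw [eval_finsetSum, finsetSum_coeff, Fintype.sum_prod_type]
  refine Finset.sum_congr rfl fun e _ ↦ ?_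
  rw [eval_mul, eval_C, eval_pow, eval_X, Finset.sum_mul, finsetSum_coeff]
  refine Finset.sum_congr rfl fun j _ ↦ ?_
  rw [mul_assoc, coeff_C_mul]

/-- A small polynomial is `h_w` for `w` its coefficient array. [folklore] -/
theorem eq_small_of_natDegree_le {P : A[X][X]} (hδ : 1 ≤ δ) (hP : P.natDegree ≤ δ - 1)
    (hPc : ∀ e, (P.coeff e).natDegree ≤ δ - 1) :
    P = ∑ e' : Fin δ,
      C (∑ j' : Fin δ, C ((P.coeff e').coeff j') * X ^ (j' : ℕ)) * X ^ (e' : ℕ) := by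
  conv_lhs => rw [eq_sum_C_mul_X_pow hδ hP]
  refine Finset.sum_congr rfl fun e _ ↦ ?_
  rw [← eq_sum_C_mul_X_pow hδ (hPc e)]

end Small

/-! ### The certificate -/

section Certificate

variable {E : Type u} [Field E] {n : ℕ}

/-- **Kaltofen's irreducibility certificate for the plane sections through a line** ([Kal95,
Thm. 5]; Cafure–Matera 2006, §3.2, Cor. 3.2 / Thm. 3.3). Let `χ ∈ E[Z][Y][X]` be irreducible of
`X`-degree `δ ≥ 1` with leading coefficient the nonzero constant `c`, of total degree `≤ δ` in
`(X, Y)`, with the coefficient of `Xᵉ Yʲ` of `Z`-degree `≤ j`, and with `χ(X, 0, Z) = g(X)` for a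
`g ∈ E[X]` having a simple root `α ∈ E`. Then there is `Υ ∈ E[Z]`, `Υ ≠ 0`, of total degree
`≤ δ²(2δ² - δ)`, such that `χ(X, Y, γ) ∈ E[Y][X]` is irreducible whenever `Υ(γ) ≠ 0`.
[cite: Kaltofen1995, Thm. 5] [cite: CafureMatera2006, Cor. 3.2] -/
theorem exists_irreducibility_certificate {χ : Polynomial (Polynomial (MvPolynomial (Fin n) E))}
    {δ : ℕ} (hδ : 1 ≤ δ) (hdeg : χ.natDegree = δ) {c : E} (hc : c ≠ 0)
    (hlead : χ.leadingCoeff = C (MvPolynomial.C c)) (hirr : Irreducible χ)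
    (htd : ∀ e j, δ < j + e → (χ.coeff e).coeff j = 0)
    (hfil : ∀ e j, ((χ.coeff e).coeff j).totalDegree ≤ j)
    {g : E[X]}
    (hred : χ.map (evalRingHom 0) = g.map (MvPolynomial.C : E →+* MvPolynomial (Fin n) E))
    {α : E} (hα : g.eval α = 0) (hα' : (derivative g).eval α ≠ 0) :
    ∃ Υ : MvPolynomial (Fin n) E, Υ ≠ 0 ∧ Υ.totalDegree ≤ δ ^ 2 * (2 * δ ^ 2 - δ) ∧
      ∀ γ : Fin n → E, MvPolynomial.eval γ Υ ≠ 0 →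
        Irreducible (χ.map (mapRingHom (MvPolynomial.eval γ))) := by
  set κ : ℕ := (2 * δ - 1) * δ + 1 with hκ
  -- consequences of the shape hypotheses
  have hχc : ∀ i, (χ.coeff i).natDegree ≤ δ := fun i ↦ by
    rw [natDegree_le_iff_coeff_eq_zero]
    intro j hj
    exact htd i j (by omega)
  have hχu : IsUnit χ.leadingCoeff := by
    rw [hlead]
    exact isUnit_C.2 ((IsUnit.mk0 c hc).map MvPolynomial.C)
  -- Step 1: a truncated root by Newton–Hensel lifting, inside the degree filtration
  set u : E := ((derivative g).eval α)⁻¹ with hu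
  have hroot0 : (X : Polynomial (MvPolynomial (Fin n) E)) ∣ χ.eval (C (MvPolynomial.C α)) := by
    refine X_dvd_eval_C_of_eval_eq_zero χ ?_
    rw [hred, eval_map, eval₂_at_apply, hα, map_zero]
  have hunit0 : (X : Polynomial (MvPolynomial (Fin n) E)) ∣
      1 - C (MvPolynomial.C u) * (derivative χ).eval (C (MvPolynomial.C α)) := by
    refine X_dvd_one_sub_of_eval_derivative χ ?_
    rw [hred, derivative_map, eval_map, eval₂_at_apply, ← map_mul, hu, inv_mul_cancel₀ hα', map_one]
  obtain ⟨a, haS, -, haroot⟩ := exists_approxRoot_of_invariant χ (MvPolynomial.C α)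
    (MvPolynomial.C u) {a | ∀ j, (a.coeff j).totalDegree ≤ j} (filtrationY_C_C α)
    (fun a ha ↦ filtrationY_newton_step hfil u ha) hroot0 hunit0 (2 * κ - 1)
  rw [show 2 * κ - 1 + 1 = 2 * κ by omega] at haroot
  have haS' : ∀ j, (a.coeff j).totalDegree ≤ j := haS
  have haroot' : (X : Polynomial (MvPolynomial (Fin n) E)) ^ κ ∣ χ.eval a :=
    (pow_dvd_pow _ (by omega)).trans haroot
  -- Step 2: the matrix of `w ↦ (h_w(a))_{k<κ}` has independent columns
  set M : Matrix (Fin κ) (Fin δ × Fin δ) (MvPolynomial (Fin n) E) :=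
    Matrix.of fun k p ↦ (X ^ (p.2 : ℕ) * a ^ (p.1 : ℕ)).coeff k with hM
  have hcols : LinearIndependent (MvPolynomial (Fin n) E) M.col := by
    rw [Fintype.linearIndependent_iff]
    intro w hw p
    set h : Polynomial (Polynomial (MvPolynomial (Fin n) E)) :=
      ∑ e' : Fin δ, C (∑ j' : Fin δ, C (w (e', j')) * X ^ (j' : ℕ)) * X ^ (e' : ℕ) with hh
    have hk : ∀ k : Fin κ, (h.eval a).coeff k = 0 := fun k ↦ by
      rw [hh, coeff_eval_small]
      have := congrFun hw k
      simp only [Finset.sum_apply, Pi.smul_apply, smul_eq_mul, Pi.zero_apply, Matrix.col_apply,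
        hM, Matrix.of_apply] at this
      rw [← this]
    have hdvd : (X : Polynomial (MvPolynomial (Fin n) E)) ^ κ ∣ h.eval a := by
      rw [X_pow_dvd_iff]
      intro d hd
      exact hk ⟨d, hd⟩
    have h0 : h = 0 :=
      eq_zero_of_pow_dvd_eval (δ := δ) (d := δ) (κ := κ) hδ hdeg hχu hirr hχc
        (natDegree_sum_C_mul_X_pow_le _ hδ)
        (fun i ↦ (natDegree_coeff_small_le w hδ i).trans (Nat.sub_le δ 1))
        (by rw [hκ]; omega) haroot' hdvd
    have := coeff_coeff_small w p.1 p.2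
    rw [← hh, h0, coeff_zero, coeff_zero] at this
    exact this.symm
  -- Step 3: degrees of the entries and a nonzero maximal minor
  have hMdeg : ∀ k p, (M k p).totalDegree ≤ (k : ℕ) := by
    intro k p
    rw [hM, Matrix.of_apply, coeff_X_pow_mul']
    split_ifs with hle
    · exact (filtrationY_pow haS' _ _).trans (Nat.sub_le _ _)
    · rw [MvPolynomial.totalDegree_zero]; exact Nat.zero_le _
  obtain ⟨f, hf, hdet, hdegΥ⟩ := exists_det_submatrix_ne_zero_totalDegree_le M hcols hMdeg
  -- (realign the `DecidableEq` instance hidden in `det`)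
  have hdet' : (M.submatrix f id).det ≠ 0 := by convert hdet
  have hdegΥ' : (M.submatrix f id).det.totalDegree ≤ Fintype.card (Fin δ × Fin δ) * (κ - 1) := by
    convert hdegΥ
  refine ⟨(M.submatrix f id).det, hdet', ?_, fun γ hγ ↦ ?_⟩
  · refine hdegΥ'.trans (le_of_eq ?_)
    have h2 : (2 * δ - 1) * δ = 2 * δ ^ 2 - δ := by
      zify [show 1 ≤ 2 * δ by omega, show δ ≤ 2 * δ ^ 2 by nlinarith]
      ring
    rw [Fintype.card_prod, Fintype.card_fin, hκ, Nat.add_sub_cancel, h2, pow_two]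
  -- Step 4: specialisation at `γ` with `Υ(γ) ≠ 0`
  set φ : MvPolynomial (Fin n) E →+* E := MvPolynomial.eval γ with hφ
  set χ₀ : E[X][X] := χ.map (mapRingHom φ) with hχ₀
  set a₀ : E[X] := a.map φ with ha₀
  have hlc : (mapRingHom φ) χ.leadingCoeff = C c := by
    rw [hlead, coe_mapRingHom, Polynomial.map_C, hφ, MvPolynomial.eval_C]
  have hlc0 : (mapRingHom φ) χ.leadingCoeff ≠ 0 := by rw [hlc]; exact C_ne_zero.2 hc
  have hdeg0 : χ₀.natDegree = δ := by
    rw [hχ₀, natDegree_map_of_leadingCoeff_ne_zero _ hlc0, hdeg]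
  have hlead0 : χ₀.leadingCoeff = C c := by
    rw [hχ₀, leadingCoeff_map_of_leadingCoeff_ne_zero _ hlc0, hlc]
  have htd0 : ∀ e j, δ < j + e → (χ₀.coeff e).coeff j = 0 := fun e j hej ↦ by
    rw [hχ₀, coeff_map, coe_mapRingHom, coeff_map, htd e j hej, map_zero]
  have hroot0' : (X : E[X]) ^ (2 * κ) ∣ χ₀.eval a₀ := by
    have := map_dvd (mapRingHom φ) haroot
    rw [coe_mapRingHom, Polynomial.map_pow, map_X, ← map_mapRingHom_eval_map] at this
    exact this
  refine irreducible_of_noSmallAnnihilator hδ hdeg0 hc hlead0 htd0 hroot0' ?_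
  intro P hPdeg hPc hPdvd
  set w₀ : Fin δ × Fin δ → E := fun p ↦ (P.coeff p.1).coeff p.2 with hw₀
  have hP : P = ∑ e' : Fin δ, C (∑ j' : Fin δ, C (w₀ (e', j')) * X ^ (j' : ℕ)) * X ^ (e' : ℕ) :=
    eq_small_of_natDegree_le hδ hPdeg hPc
  -- the specialised matrix kills `w₀`
  have hentry : ∀ (k : ℕ) (p : Fin δ × Fin δ),
      (X ^ (p.2 : ℕ) * a₀ ^ (p.1 : ℕ) : E[X]).coeff k =
        φ ((X ^ (p.2 : ℕ) * a ^ (p.1 : ℕ)).coeff k) := by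
    intro k p
    rw [← coeff_map, Polynomial.map_mul, Polynomial.map_pow, Polynomial.map_pow, map_X]
  have hmul : ((M.submatrix f id).map φ).mulVec w₀ = 0 := by
    funext i
    rw [Matrix.mulVec, Pi.zero_apply, dotProduct]
    have hk : (P.eval a₀).coeff (f i) = 0 := by
      rw [X_pow_dvd_iff] at hPdvd
      exact hPdvd _ (f i).2
    rw [hP, coeff_eval_small] at hk
    rw [← hk]
    refine Finset.sum_congr rfl fun p _ ↦ ?_
    rw [Matrix.map_apply, Matrix.submatrix_apply, hM, Matrix.of_apply, id, hentry, mul_comm]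
  have hdet0 : ((M.submatrix f id).map φ).det ≠ 0 := by
    rw [← RingHom.mapMatrix_apply, ← RingHom.map_det]
    exact hγ
  have hw0 : w₀ = 0 := Matrix.eq_zero_of_mulVec_eq_zero hdet0 hmul
  rw [hP, hw0]
  simp

end Certificate

end Literature.NumberTheory.DiophantineGeometry
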